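import Summits.MatrixMultiplication.MatrixMultiplication.Theorems.EdgePencilSixth
import Summits.MatrixMultiplication.MatrixMultiplication.Theorems.EdgePencilExcess
import HarnessLib

/-!
# The sixth-edge ladder in exponents: `χ(δ)`, its profile, and the convergence
# `ExcessZero ⟺ ∀ δ < 1, χ(δ) = ω(2,1,2)` with a PROVED bottom rung `χ(0) = ω(2,1,2)`

Support kernel for `stmt-MatrixMultiplication-33477` (`TetraFlat`) of route `TetrahedronCarving`
(lineage `decomp-mm-lens-6`, generation 20). `EdgePencilExcess` split the attacked leaf as
`TetraFlat ⟺ (α ≥ 1/2) ∧ ExcessZero`, `ExcessZero : ω(K₄) ≤ ω(2,1,2)`; `EdgePencilSixth` built the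
family `W_n^{(e)}` (edge `01` of bond `e`). Here `χ(δ)` is the exponent of `n ↦ W_n^{(⌈n^δ⌉)}` and:

* §1 PROFILE: `ω(2,1,2) = ψ(1) ≤ χ(δ) ≤ min(ω(K₄), ω(2,1,2) + δ)` and `ω(K₄) ≤ χ(δ) + (1 − δ)`
  (`0 ≤ δ ≤ 1`); `χ(0) = ω(2,1,2)` (the diamond, `EdgePencilTriangles`), `χ(1) = ω(K₄)`; `χ` monotone.
  So the SIXTH-EDGE EXCESS `χ(δ) − ω(2,1,2) ∈ [0, δ]` grows from `0` to the excess `ω(K₄) − ω(2,1,2)`.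
* §2 RUNGS `SixRung(δ) : χ(δ) ≤ ω(2,1,2)`: the bottom rung `δ = 0` is a THEOREM; `ExcessZero ⟹` every
  rung; a rung at `δ` gives `ω(K₄) ≤ ω(2,1,2) + (1 − δ)` — partial progress on the leaf's own quantity,
  new as soon as `ω(2,1,2) + 1 − δ` undercuts the printed `ω(K₄) < 4.633908`; and the ladder CONVERGES:
  `ExcessZero ⟺ ∀ δ ∈ [0,1), SixRung(δ)`; hence `TetraFlat ⟺ (α ≥ 1/2) ∧ ∀ δ<1, SixRung(δ)` and
  `ω = 2 ⟺ (∀ δ<1, SixRung(δ)) ∧ TetraNoSaving`. Every rung is NEC (`ω = 2 ⟹ SixRung(δ)`).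

This is the analogue, for the weakened leaf `ExcessZero`, of the diagonal ladder of generation 19
(`TetraDiagonalLimit`: `TetraFlat ⟺ ∀ ε<1, ω_diag(ε) ≤ 4`), with block sums in place of symmetrisation.

References: Christandl–Vrana–Zuiddam, arXiv:1609.07476, §1.1–1.3. [ChristandlVranaZuiddam2016]
-/

noncomputable section

set_option linter.dupNamespace false

open Filter Asymptotics Literature.Computability.AlgebraicComplexity
open Summit.MatrixMultiplication.MatrixMultiplication.Theorems.TetrahedronTensor
open Summit.MatrixMultiplication.MatrixMultiplication.Theorems.TetraDiagonal
open Summit.MatrixMultiplication.MatrixMultiplication.Theses.TetrahedronCarving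

namespace Summit.MatrixMultiplication.MatrixMultiplication.Theorems.EdgePencil

section Defs

variable (F : Type) [Field F]

/-- Admissible exponents of the sixth-edge family `n ↦ W_n^{(⌈n^δ⌉)}`. (CVZ19 Def. 1.1.13). -/
def sixAdmissibleExponents (δ : ℝ) : Set ℝ :=
  {β : ℝ | (fun n : ℕ => (tensorRankD (sixTetra F n (rectDim n δ)) : ℝ)) =O[atTop]
    fun n : ℕ => (n : ℝ) ^ β}

/-- **The sixth-edge exponent** `χ(δ) = inf {β | R₄(W_n^{(⌈n^δ⌉)}) = O(n^β)}`: `χ(0) = ψ(1)` is the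
diamond, `χ(1) = ω(K₄)` the tetrahedron. (CVZ19 Def. 1.1.25, non-uniform bond dimensions). -/
def omegaSix (δ : ℝ) : ℝ :=
  sInf (sixAdmissibleExponents F δ)

end Defs

/-! ## §1 The profile of `χ` -/

section Profile

variable (F : Type) [Field F]

/-- Restriction: admissible for `T(K₄)` ⟹ admissible for `W^δ`. -/
theorem tetraAdmissibleExponents_subset_six (δ : ℝ) :
    tetraAdmissibleExponents F ⊆ sixAdmissibleExponents F δ := by
  intro β hβ
  refine IsBigO.trans ?_ hβ
  refine IsBigO.of_bound 1 (Eventually.of_forall fun n => ?_)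
  rw [one_mul, Real.norm_of_nonneg (Nat.cast_nonneg _), Real.norm_of_nonneg (Nat.cast_nonneg _)]
  exact_mod_cast tensorRankD_sixTetra_le_tetra (F := F) n (rectDim n δ)

/-- The diamond sits in every member: admissible for `W^δ` ⟹ admissible for the diamond `ψ(1)`. -/
theorem sixAdmissibleExponents_subset_pencil_one (δ : ℝ) :
    sixAdmissibleExponents F δ ⊆ pencilAdmissibleExponents F 1 := by
  intro β hβ
  refine IsBigO.trans ?_ hβ
  refine IsBigO.of_bound 1 ?_
  filter_upwards [eventually_ge_atTop 1] with n hn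
  rw [one_mul, Real.norm_of_nonneg (Nat.cast_nonneg _), Real.norm_of_nonneg (Nat.cast_nonneg _),
    rectDim_one]
  exact_mod_cast tensorRankD_pencil_le_sixTetra (F := F) (one_le_rectDim hn δ)

/-- Thinner sixth edge is cheaper: `δ ≤ δ'` ⟹ admissible for `δ'` is admissible for `δ`. -/
theorem sixAdmissibleExponents_anti {δ δ' : ℝ} (h : δ ≤ δ') :
    sixAdmissibleExponents F δ' ⊆ sixAdmissibleExponents F δ := by
  intro β hβ
  refine IsBigO.trans ?_ hβ
  refine IsBigO.of_bound 1 ?_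
  filter_upwards [eventually_ge_atTop 1] with n hn
  rw [one_mul, Real.norm_of_nonneg (Nat.cast_nonneg _), Real.norm_of_nonneg (Nat.cast_nonneg _)]
  exact_mod_cast tensorRankD_sixTetra_mono (F := F) (n := n) (rectDim_mono hn h)

/-- Saturation: for `δ ≥ 1` the family is (eventually) `T(K₄)_n`. -/
theorem sixAdmissibleExponents_of_one_le {δ : ℝ} (h : 1 ≤ δ) :
    sixAdmissibleExponents F δ = tetraAdmissibleExponents F := by
  have he : (fun n : ℕ => (tensorRankD (sixTetra F n (rectDim n δ)) : ℝ)) =ᶠ[atTop]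
      fun n : ℕ => (tensorRankD (tetra F n) : ℝ) := by
    filter_upwards [eventually_ge_atTop 1] with n hn
    have hle : n ≤ rectDim n δ := by simpa [rectDim_one] using rectDim_mono hn h
    rw [sixTetra_of_le hle]
  ext β
  exact ⟨fun hβ => hβ.congr' he EventuallyEq.rfl, fun hβ => hβ.congr' he.symm EventuallyEq.rfl⟩

/-- At `δ = 0` the family IS the diamond family. -/
theorem sixAdmissibleExponents_zero :
    sixAdmissibleExponents F 0 = pencilAdmissibleExponents F 1 := by
  ext β
  simp only [sixAdmissibleExponents, pencilAdmissibleExponents, Set.mem_setOf_eq, rectDim_zero,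
    rectDim_one, sixTetra_one]

/-- Nonempty (`6` is admissible). -/
theorem sixAdmissibleExponents_nonempty (δ : ℝ) : (sixAdmissibleExponents F δ).Nonempty :=
  ⟨6, tetraAdmissibleExponents_subset_six F δ (six_mem_tetraAdmissibleExponents F)⟩

/-- Bounded below (by the diamond's floor). -/
theorem sixAdmissibleExponents_bddBelow (δ : ℝ) : BddBelow (sixAdmissibleExponents F δ) :=
  (pencilAdmissibleExponents_bddBelow F le_rfl).mono (sixAdmissibleExponents_subset_pencil_one F δ)

/-- **`χ(δ) ≤ ω(K₄)`**. [folklore] -/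
theorem omegaSix_le_omegaTetra (δ : ℝ) : omegaSix F δ ≤ omegaTetra F :=
  csInf_le_csInf (sixAdmissibleExponents_bddBelow F δ) (tetraAdmissibleExponents_nonempty F)
    (tetraAdmissibleExponents_subset_six F δ)

/-- **`ψ(1) ≤ χ(δ)`**. [folklore] -/
theorem omegaPencil_one_le_omegaSix (δ : ℝ) : omegaPencil F 1 ≤ omegaSix F δ :=
  csInf_le_csInf (pencilAdmissibleExponents_bddBelow F le_rfl) (sixAdmissibleExponents_nonempty F δ)
    (sixAdmissibleExponents_subset_pencil_one F δ)

/-- **`ω(2,1,2) ≤ χ(δ)`** (the diamond is rectangular: `ψ(1) = ω(2,1,2)`). -/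
theorem omegaRect_two_one_two_le_omegaSix (δ : ℝ) : omegaRect F 2 1 2 ≤ omegaSix F δ := by
  rw [← omegaPencil_one_eq_omegaRect_two_one_two]
  exact omegaPencil_one_le_omegaSix F δ

/-- `4 ≤ χ(δ)`. -/
theorem four_le_omegaSix (δ : ℝ) : 4 ≤ omegaSix F δ :=
  (four_le_omegaRect_two_one_two F).trans (omegaRect_two_one_two_le_omegaSix F δ)

/-- Monotone in `δ`. [folklore] -/
theorem omegaSix_mono {δ δ' : ℝ} (h : δ ≤ δ') : omegaSix F δ ≤ omegaSix F δ' :=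
  csInf_le_csInf (sixAdmissibleExponents_bddBelow F δ) (sixAdmissibleExponents_nonempty F δ')
    (sixAdmissibleExponents_anti F h)

/-- `χ(δ) = ω(K₄)` for `δ ≥ 1`. -/
theorem omegaSix_of_one_le {δ : ℝ} (h : 1 ≤ δ) : omegaSix F δ = omegaTetra F := by
  rw [omegaSix, sixAdmissibleExponents_of_one_le F h]
  rfl

/-- **Top of the ladder**: `χ(1) = ω(K₄)`. -/
theorem omegaSix_one : omegaSix F 1 = omegaTetra F := omegaSix_of_one_le F le_rfl

/-- **BOTTOM OF THE LADDER (a theorem)**: `χ(0) = ψ(1) = ω(2,1,2)`. -/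
theorem omegaSix_zero : omegaSix F 0 = omegaRect F 2 1 2 := by
  rw [omegaSix, sixAdmissibleExponents_zero, ← omegaPencil_one_eq_omegaRect_two_one_two]
  rfl

/-- **Block cover in exponents**: `β` admissible for the diamond ⟹ `β + δ` admissible for `W^δ`
(`δ ≥ 0`; `R₄(W_n^{(⌈n^δ⌉)}) ≤ ⌈n^δ⌉ · R₄(D_n)`). -/
theorem add_mem_sixAdmissibleExponents {δ β : ℝ} (hδ : 0 ≤ δ)
    (hβ : β ∈ pencilAdmissibleExponents F 1) : β + δ ∈ sixAdmissibleExponents F δ := by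
  obtain ⟨C, hC0, hC⟩ := bound_of_isBigO_nat_atTop hβ
  refine IsBigO.of_bound (2 * C) ?_
  filter_upwards [eventually_ge_atTop 1] with n hn
  have hn0 : (0 : ℝ) < n := by exact_mod_cast hn
  have hR : (tensorRankD (pencil F n n) : ℝ) ≤ C * (n : ℝ) ^ β := by
    have h := hC (Real.rpow_pos_of_pos hn0 β).ne'
    rwa [Real.norm_of_nonneg (Nat.cast_nonneg _), Real.norm_of_nonneg (Real.rpow_nonneg hn0.le _),
      rectDim_one] at h
  have hd : (rectDim n δ : ℝ) ≤ 2 * (n : ℝ) ^ δ := by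
    have h := rectDim_le hn δ
    rwa [max_eq_left hδ] at h
  rw [Real.norm_of_nonneg (Nat.cast_nonneg _), Real.norm_of_nonneg (Real.rpow_nonneg hn0.le _),
    Real.rpow_add hn0]
  have hfin := tensorRankD_sixTetra_le_mul_diamond (F := F) n (rectDim n δ)
  calc (tensorRankD (sixTetra F n (rectDim n δ)) : ℝ)
      ≤ (rectDim n δ : ℝ) * (tensorRankD (pencil F n n) : ℝ) := by exact_mod_cast hfin
    _ ≤ (2 * (n : ℝ) ^ δ) * (C * (n : ℝ) ^ β) :=
        mul_le_mul hd hR (Nat.cast_nonneg _) (by positivity)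
    _ = 2 * C * ((n : ℝ) ^ β * (n : ℝ) ^ δ) := by ring

/-- **`χ(δ) ≤ ψ(1) + δ = ω(2,1,2) + δ`** (`δ ≥ 0`): the sixth edge costs at most its bond. -/
theorem omegaSix_le_add {δ : ℝ} (hδ : 0 ≤ δ) : omegaSix F δ ≤ omegaRect F 2 1 2 + δ := by
  rw [← omegaPencil_one_eq_omegaRect_two_one_two]
  have h : ∀ β ∈ pencilAdmissibleExponents F 1, omegaSix F δ - δ ≤ β := fun β hβ => by
    have h2 := csInf_le (sixAdmissibleExponents_bddBelow F δ) (add_mem_sixAdmissibleExponents F hδ hβ)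
    change omegaSix F δ ≤ β + δ at h2
    linarith
  have h3 := le_csInf (pencilAdmissibleExponents_nonempty F 1) h
  change omegaSix F δ - δ ≤ omegaPencil F 1 at h3
  linarith

/-- **Top continuity in exponents**: `β` admissible for `W^δ` ⟹ `β + (1 − δ)` admissible for `T(K₄)`
(`δ ≤ 1`; `R₄(T(K₄)_n) ≤ (⌊n/⌈n^δ⌉⌋ + 1) · R₄(W_n^{(⌈n^δ⌉)})` and `⌊n/⌈n^δ⌉⌋ ≤ ⌈n^{1−δ}⌉`). -/
theorem add_mem_tetraAdmissibleExponents_of_six {δ β : ℝ} (hδ1 : δ ≤ 1)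
    (hβ : β ∈ sixAdmissibleExponents F δ) : β + (1 - δ) ∈ tetraAdmissibleExponents F := by
  obtain ⟨C, hC0, hC⟩ := bound_of_isBigO_nat_atTop hβ
  refine IsBigO.of_bound (4 * C) ?_
  filter_upwards [eventually_ge_atTop 1] with n hn
  have hn0 : (0 : ℝ) < n := by exact_mod_cast hn
  have hR : (tensorRankD (sixTetra F n (rectDim n δ)) : ℝ) ≤ C * (n : ℝ) ^ β := by
    have h := hC (Real.rpow_pos_of_pos hn0 β).ne'
    rwa [Real.norm_of_nonneg (Nat.cast_nonneg _), Real.norm_of_nonneg (Real.rpow_nonneg hn0.le _)]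
      at h
  have hd0 : 0 < rectDim n δ := one_le_rectDim hn δ
  -- `⌊n/⌈n^δ⌉⌋ + 1 ≤ ⌈n^{1-δ}⌉ + 1 ≤ 2⌈n^{1-δ}⌉ ≤ 4 n^{1-δ}`
  have hdiv : n / rectDim n δ + 1 ≤ 2 * rectDim n (1 - δ) := by
    have h1 : n / rectDim n δ ≤ rectDim n (1 - δ) :=
      Nat.div_le_of_le_mul (le_rectDim_mul_rectDim n δ)
    have h2 := one_le_rectDim hn (1 - δ)
    omega
  have hd : ((n / rectDim n δ + 1 : ℕ) : ℝ) ≤ 4 * (n : ℝ) ^ (1 - δ) := by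
    have h := rectDim_le hn (1 - δ)
    rw [max_eq_left (by linarith)] at h
    calc ((n / rectDim n δ + 1 : ℕ) : ℝ) ≤ ((2 * rectDim n (1 - δ) : ℕ) : ℝ) := by exact_mod_cast hdiv
      _ = 2 * (rectDim n (1 - δ) : ℝ) := by push_cast; ring
      _ ≤ 4 * (n : ℝ) ^ (1 - δ) := by linarith
  rw [Real.norm_of_nonneg (Nat.cast_nonneg _), Real.norm_of_nonneg (Real.rpow_nonneg hn0.le _),
    Real.rpow_add hn0]
  have hfin := tensorRankD_tetra_le_ceilDiv_sixTetra (F := F) (n := n) hd0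
  calc (tensorRankD (tetra F n) : ℝ)
      ≤ ((n / rectDim n δ + 1 : ℕ) : ℝ) * (tensorRankD (sixTetra F n (rectDim n δ)) : ℝ) := by
        exact_mod_cast hfin
    _ ≤ (4 * (n : ℝ) ^ (1 - δ)) * (C * (n : ℝ) ^ β) :=
        mul_le_mul hd hR (Nat.cast_nonneg _) (by positivity)
    _ = 4 * C * ((n : ℝ) ^ β * (n : ℝ) ^ (1 - δ)) := by ring

/-- **`ω(K₄) ≤ χ(δ) + (1 − δ)`** (`δ ≤ 1`): continuity of the ladder at the top. -/
theorem omegaTetra_le_omegaSix_add {δ : ℝ} (hδ1 : δ ≤ 1) :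
    omegaTetra F ≤ omegaSix F δ + (1 - δ) := by
  have h : ∀ β ∈ sixAdmissibleExponents F δ, omegaTetra F - (1 - δ) ≤ β := fun β hβ => by
    have h2 := csInf_le (tetraAdmissibleExponents_bddBelow F)
      (add_mem_tetraAdmissibleExponents_of_six F hδ1 hβ)
    change omegaTetra F ≤ β + (1 - δ) at h2
    linarith
  have h3 := le_csInf (sixAdmissibleExponents_nonempty F δ) h
  change omegaTetra F - (1 - δ) ≤ omegaSix F δ at h3
  linarith

/-- **THE PROFILE** (`0 ≤ δ ≤ 1`): `max(ω(2,1,2), ω(K₄) − (1−δ)) ≤ χ(δ) ≤ min(ω(K₄), ω(2,1,2) + δ)`. -/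
theorem omegaSix_sandwich {δ : ℝ} (hδ0 : 0 ≤ δ) (hδ1 : δ ≤ 1) :
    omegaRect F 2 1 2 ≤ omegaSix F δ ∧ omegaTetra F - (1 - δ) ≤ omegaSix F δ ∧
      omegaSix F δ ≤ omegaTetra F ∧ omegaSix F δ ≤ omegaRect F 2 1 2 + δ :=
  ⟨omegaRect_two_one_two_le_omegaSix F δ, by linarith [omegaTetra_le_omegaSix_add F hδ1],
    omegaSix_le_omegaTetra F δ, omegaSix_le_add F hδ0⟩

/-- The sixth-edge excess `χ(δ) − ω(2,1,2)` lies in `[0, δ]` and reaches the full excess at `δ = 1`. -/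
theorem sixExcess_window {δ : ℝ} (hδ0 : 0 ≤ δ) :
    0 ≤ omegaSix F δ - omegaRect F 2 1 2 ∧ omegaSix F δ - omegaRect F 2 1 2 ≤ δ ∧
      omegaSix F 1 - omegaRect F 2 1 2 = omegaTetra F - omegaRect F 2 1 2 := by
  refine ⟨sub_nonneg.2 (omegaRect_two_one_two_le_omegaSix F δ),
    by linarith [omegaSix_le_add F hδ0], by rw [omegaSix_one]⟩

end Profile

/-! ## §2 Rungs and convergence -/

section Rungs

variable (F : Type) [Field F]

/-- `SixRung(δ)` as a value: `χ(δ) ≤ ω(2,1,2) ⟺ χ(δ) = ω(2,1,2)`. -/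
theorem omegaSix_le_iff_eq (δ : ℝ) :
    omegaSix F δ ≤ omegaRect F 2 1 2 ↔ omegaSix F δ = omegaRect F 2 1 2 :=
  ⟨fun h => le_antisymm h (omegaRect_two_one_two_le_omegaSix F δ), fun h => h.le⟩

/-- **The bottom rung is a theorem**: `χ(0) ≤ ω(2,1,2)`. -/
theorem sixRung_zero : omegaSix F 0 ≤ omegaRect F 2 1 2 := (omegaSix_zero F).le

/-- `ExcessZero ⟹` every rung (restriction). -/
theorem sixRung_of_excessZero (hE : omegaTetra F ≤ omegaRect F 2 1 2) (δ : ℝ) :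
    omegaSix F δ ≤ omegaRect F 2 1 2 :=
  (omegaSix_le_omegaTetra F δ).trans hE

/-- Rungs are downward closed in `δ`. -/
theorem sixRung_anti {δ δ' : ℝ} (h : δ ≤ δ') (hr : omegaSix F δ' ≤ omegaRect F 2 1 2) :
    omegaSix F δ ≤ omegaRect F 2 1 2 :=
  (omegaSix_mono F h).trans hr

/-- **A rung is partial progress on the leaf's own quantity**:
`χ(δ) ≤ ω(2,1,2) ⟹ ω(K₄) ≤ ω(2,1,2) + (1 − δ)` (`δ ≤ 1`). -/
theorem omegaTetra_le_of_sixRung {δ : ℝ} (hδ1 : δ ≤ 1)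
    (hr : omegaSix F δ ≤ omegaRect F 2 1 2) : omegaTetra F ≤ omegaRect F 2 1 2 + (1 - δ) := by
  linarith [omegaTetra_le_omegaSix_add F hδ1]

/-- News threshold: a rung at `δ` with `ω(2,1,2) + 1 − δ < c` gives `ω(K₄) < c` (take `c` the printed
bound `4.633908`). -/
theorem omegaTetra_lt_of_sixRung {δ c : ℝ} (hδ1 : δ ≤ 1)
    (hr : omegaSix F δ ≤ omegaRect F 2 1 2) (hc : omegaRect F 2 1 2 + (1 - δ) < c) :
    omegaTetra F < c :=
  lt_of_le_of_lt (omegaTetra_le_of_sixRung F hδ1 hr) hc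

/-- **THE LADDER CONVERGES**: `ExcessZero ⟺ ∀ δ ∈ [0,1), SixRung(δ)`. -/
theorem excessZero_iff_forall_sixRung :
    omegaTetra F ≤ omegaRect F 2 1 2 ↔
      ∀ δ : ℝ, 0 ≤ δ → δ < 1 → omegaSix F δ ≤ omegaRect F 2 1 2 := by
  constructor
  · intro hE δ _ _
    exact sixRung_of_excessZero F hE δ
  · intro h
    refine le_of_forall_pos_lt_add fun η hη => ?_
    -- take `δ = max 0 (1 - η/2)`
    have hδ0 : (0 : ℝ) ≤ max 0 (1 - η / 2) := le_max_left _ _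
    have hδ1 : max 0 (1 - η / 2) < 1 := max_lt (by norm_num) (by linarith)
    have h1 := omegaTetra_le_of_sixRung F hδ1.le (h _ hδ0 hδ1)
    have h2 : 1 - max 0 (1 - η / 2) ≤ η / 2 := by
      have := le_max_right (0 : ℝ) (1 - η / 2)
      linarith
    linarith

/-- **The attacked leaf through the ladder**: `TetraFlat ⟺ (α ≥ 1/2) ∧ ∀ δ ∈ [0,1), SixRung(δ)`. -/
theorem tetraFlat_iff_halfAlpha_and_forall_sixRung :
    TetraFlat ↔ 1 / 2 ≤ dualExponentAlpha ℂ ∧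
      ∀ δ : ℝ, 0 ≤ δ → δ < 1 → omegaSix ℂ δ ≤ omegaRect ℂ 2 1 2 := by
  rw [tetraFlat_iff_halfAlpha_and_excessZero, excessZero_iff_forall_sixRung]

/-- Every rung is NECESSARY: `ω = 2 ⟹ SixRung(δ)`. -/
theorem sixRung_of_matrixMultiplication (hS : _root_.MatrixMultiplication) (δ : ℝ) :
    omegaSix ℂ δ ≤ omegaRect ℂ 2 1 2 :=
  sixRung_of_excessZero ℂ (excessZero_of_matrixMultiplication hS) δ

/-- **The weakened cut through the ladder**: `ω = 2 ⟺ (∀ δ ∈ [0,1), SixRung(δ)) ∧ TetraNoSaving`. -/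
theorem matrixMultiplication_iff_sixRungs_and_tetraNoSaving :
    _root_.MatrixMultiplication ↔
      (∀ δ : ℝ, 0 ≤ δ → δ < 1 → omegaSix ℂ δ ≤ omegaRect ℂ 2 1 2) ∧ TetraNoSaving := by
  rw [matrixMultiplication_iff_excessZero_and_tetraNoSaving, excessZero_iff_forall_sixRung]

/-- Under `ω = 2` the whole ladder is flat: `χ(δ) = 4` for `0 ≤ δ`… indeed for every `δ`
(`4 ≤ χ(δ) ≤ ω(K₄) = 4`). -/
theorem omegaSix_eq_four_of_matrixMultiplication (hS : _root_.MatrixMultiplication) (δ : ℝ) :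
    omegaSix ℂ δ = 4 :=
  le_antisymm ((omegaSix_le_omegaTetra ℂ δ).trans (omegaTetra_le_four_of_matrixMultiplication hS))
    (four_le_omegaSix ℂ δ)

/-- If `TetraFlat` fails with `ω(K₄) ≥ ω(2,1,2) + η`, every rung with `δ > 1 − η` fails
(contrapositive of `omegaTetra_le_of_sixRung`): a refuter's handle on the ladder. -/
theorem not_sixRung_of_excess {δ η : ℝ} (hδ1 : δ ≤ 1) (hη : 1 - η < δ)
    (hex : omegaRect F 2 1 2 + η ≤ omegaTetra F) : ¬ omegaSix F δ ≤ omegaRect F 2 1 2 := by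
  intro hr
  have := omegaTetra_le_of_sixRung F hδ1 hr
  linarith

end Rungs

end Summit.MatrixMultiplication.MatrixMultiplication.Theorems.EdgePencil

end
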